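import Summits.ResolutionOfSingularities.ResolutionOfSingularities.Theses.UniformComplexity
import Summits.ResolutionOfSingularities.ResolutionOfSingularities.Theorems.UniformComplexityPrimeModelTransferAlgClosedTower
import Summits.ResolutionOfSingularities.ResolutionOfSingularities.Theorems.UniformComplexityCampaignW82PerfectionStepAlgClosedRungs
import HarnessLib

/-!
# Crux `PrimeModelTransfer` (stmt-ResolutionOfSingularities-8933) from the door-2 PERFECTION STEP alone

Route `ResolutionOfSingularities/UniformComplexity`, crux `PrimeModelTransfer`. Leaf file (imports the
route file `Theses.UniformComplexity` directly and otherwise only Theses-free modules: the tower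
p470438 and the door-2 rungs `…CampaignW82PerfectionStepAlgClosedRungs`).

State of door 2 of slot W8.2 after res-L1-s82-pv-1's `familyTransferSucc_holds` (p475166: the
finite-level FAMILY transfer "resolution over a constant field `M` ⇒ resolution over `RatFunc M`" is a
THEOREM for every `M` — regular total space, the form the transport barriers allow) and this seat's
algebraically closed tower (p470438 / p470915 / p474537 / p475050):

    primeModelTransfer_of_forall_perfectionStepAlgClosedDimLe_top :
      (∀ p prime, CampaignW82.PerfectionStepAlgClosedDimLe p ⊤) → UniformComplexity.PrimeModelTransfer

i.e. the crux `𝔽_p`-bar ⇒ every algebraically closed field of characteristic `p` now hangs on ONE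
OURS statement (typer res-L1-type-o6, p470934, lanes A/B signed): for `M` ALGEBRAICALLY CLOSED of
characteristic `p`, resolution of integral separated finite-type schemes over `M(t) = RatFunc M`
implies resolution over every perfect field purely inseparable over `M(t)` (`≅ M(t)^{perf}`) — the
passage from a REGULAR model over the imperfect `M(t)` to a model SMOOTH over some finite level
`M(t^{1/p^e})`. Rungs `n ≤ 3` of its grading hold (p475542, from `CossartPiltant2019`); `n = 4` over
`𝔽̄_p(t)` is the first open case. Nothing here attacks that statement.

[OURS · LADDER-RESOLUTION L1, slot W8.2 (prime-field / universality transfer), door 2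
UniformComplexity] Pure-logic assembly over the summit's own route; NOT a statement of, and attributing
nothing to, Hironaka's 2017 manuscript.
-/

noncomputable section

set_option linter.dupNamespace false -- mandated namespace of this single-conjunct summit

open CategoryTheory CategoryTheory.Limits AlgebraicGeometry
open Literature.AlgebraicGeometry.Resolution

namespace Summit.ResolutionOfSingularities.ResolutionOfSingularities.Theorems.CampaignW82

/-- **`PrimeModelTransfer` from the door-2 perfection step at grade `⊤`.** If, for every prime `p`
and every algebraically closed `M` of characteristic `p`, resolution of all integral separated
finite-type schemes over `RatFunc M` implies the same over every perfect field purely inseparable over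
`RatFunc M` (`PerfectionStepAlgClosedDimLe p ⊤`), then `UniformComplexity.PrimeModelTransfer` holds:
the perfection step gives the door-2 kernel (`climbRatFuncPerfAlgClosed_of_perfectionStepAlgClosed_top`,
using `familyTransferSucc_holds`), which feeds the algebraically closed tower
(`PrimeModelTransfer.exists_isAlgClosed_subfield_hasResolution`) and the descent to `K`
(`PrimeModelTransfer.hasResolution_of_perfectSubfields`). [folklore] -/
theorem primeModelTransfer_of_forall_perfectionStepAlgClosedDimLe_top
    (h : ∀ p : ℕ, p.Prime → PerfectionStepAlgClosedDimLe p ⊤) :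
    Summit.ResolutionOfSingularities.ResolutionOfSingularities.Theses.UniformComplexity.PrimeModelTransfer := by
  intro p hp hA K _ _ _ X f hs hl hq hX
  haveI : Fact p.Prime := ⟨hp⟩
  haveI : PerfectField K := IsAlgClosed.perfectField K
  have hker : ClimbRatFuncPerfAlgClosed p :=
    climbRatFuncPerfAlgClosed_of_perfectionStepAlgClosed_top (h p hp)
  refine PrimeModelTransfer.hasResolution_of_perfectSubfields K (fun s => ?_) X f hs hl hq hX
  obtain ⟨A, hsA, hAc, hAres⟩ :=
    PrimeModelTransfer.exists_isAlgClosed_subfield_hasResolution p K (fun k _ _ _ hk => hA k hk)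
      (fun M _ _ _ hM L _ _ _ _ => hker M hM L) s
  haveI : IsAlgClosed A := hAc
  exact ⟨A, hsA, IsAlgClosed.perfectField A, hAres⟩

/-- **Graded reading**: the same from the family of all finite grades is not needed — the single
grade `⊤` suffices — but for the record, `PrimeModelTransfer` also follows from the door-2 graded
kernel at `(⊤, ⊤)` supplied by the perfection step (`climbRatFuncPerfAlgClosedDimLe_of_perfectionStepAlgClosed`
with `⊤ + 1 ≤ ⊤`). [folklore] -/
theorem climbRatFuncPerfAlgClosedDimLe_top_top_of_perfectionStepAlgClosed_top {p : ℕ}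
    (h : PerfectionStepAlgClosedDimLe p ⊤) : ClimbRatFuncPerfAlgClosedDimLe p ⊤ ⊤ :=
  (climbRatFuncPerfAlgClosed_iff_top p).1 (climbRatFuncPerfAlgClosed_of_perfectionStepAlgClosed_top h)

end Summit.ResolutionOfSingularities.ResolutionOfSingularities.Theorems.CampaignW82

end
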